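import Summits.ResolutionOfSingularities.ResolutionOfSingularities.Theorems.HomologicalConductorNoZenoTwoCurvesUpstairs
import Summits.ResolutionOfSingularities.ResolutionOfSingularities.Theorems.HomologicalConductorNoZenoFiniteCentreBlowup
import Summits.ResolutionOfSingularities.ResolutionOfSingularities.Theorems.HomologicalConductorNoZenoTransversal
import HarnessLib

/-!
# Crux `NoZenoR` (stmt-ResolutionOfSingularities-19943), slot 5 `stub_L1wCoreF3` — (S3) HSPLIT UPSTAIRS: two distinct
# exceptional curves of `π_f` through every point of the upstairs centre `σ⁻¹(sepNodes π)`

OURS (cell res-hironaka, chain W4.4; CONVERT seat res-D-pv-045 g8; object (S3) of res-L0-w44-plan-1 DESK WORD 20 (b), lead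
res-L0-w44-lead-1 g9 seam2 binder `hnode`).  Nothing here is a statement of the manuscript under review (Hironaka 2017); AI-written,
weaker than expert review; def-free, fact-free (every outside input enters through a hypothesis stated by signature).

THE OUTPUT is the `hsplit` input of `FiniteCentreBlowup.subdivision_finiteCentre` (res-L1-type-o5) for the UPSTAIRS resolution
`π_f : X_f → Spec R_f` and the centre `N := σ⁻¹(sepNodes π)`:
`∀ z₁, σ z₁ ∈ sepNodes π → ∃ a ≠ b ∈ excCurvePoints π_f, a ⤳ z₁ ∧ b ⤳ z₁`.

Setting: the downstairs square `σ ≫ π = π_f ≫ g`, `g⁻¹{𝔪_R} = {𝔪_{R_f}}` with `σ : X_f → X` flat, universally closed, locally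
quasi-finite (res-L0-w44-stub-4's `…NoZenoTwoCurvesUpstairs` currency), and the upstairs square `σ¹ ≫ ρ = ρ_f ≫ σ` of the blow-ups
`ρ : X¹ → X` (centre `sepNodes π`) and `ρ_f : X¹_f → X_f` (centre `σ⁻¹(sepNodes π)`), `σ¹` again flat, universally closed,
locally quasi-finite.

* TWO-CURVE NODES (`σ z₁` on two distinct exceptional curves of `π`): stub-4's `exists_two_excCurvePoints_specializes_of_sq'`.
* SELF-NODES (`σ z₁` on exactly one exceptional curve `E_η` of `π`): the input `htwo` — TWO DISTINCT POINTS `y₁ ≠ y₂` of `X¹_f`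
  over `z₁` lying under the strict transform `η¹` of `η` (= stub-3's lift + (S1) «sep-jump» + (S2a-sch)/(S2a) «the fibre splits»,
  bundled by signature) — is turned into two distinct curves through `z₁`: lift `η¹` through `y₁`, `y₂` along the flat `σ¹` to OLD
  curves `e₁`, `e₂` of `ρ_f ≫ π_f` (`exists_excCurvePoint_specializes_of_sq`); the NEW curve `n₁ = ρ_f⁻¹{z₁}` passes through both
  `y_j` (`hcurve`, o5's `exists_curve_fibre_eq_closure`); `e₁ = e₂` would put the two distinct curves `e₁`, `n₁` through the two
  distinct points `y₁ ≠ y₂` — excluded on a rational resolution by (T1) `eq_of_specializes_of_specializes` (hypothesis `hT1`);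
  so `a := ρ_f e₁ ≠ b := ρ_f e₂` (`ρ_f` injective on old curves, o5's `excCurvePoints_eq_image`) are the two curves.
* `exists_two_of_two_points` — the point-set core; `exists_two_excCurvePoints_of_selfNode` — the self-node step;
  **`hsplit_upstairs`** — the assembly; `hsplit_upstairs_of_isBlowup` — the same with `hcurve`/`himg`/`hinj`/`hT1` discharged from
  o5's `FiniteCentreBlowup.*` and (T1) (conditional on `Lipman1969_13_1_d_rat`, through (T1)).

References: J. Lipman, Publ. Math. IHÉS 36 (1969), §16 (16.1) p. 231, §22 (22.4) p. 250, §24 p. 258 [`Lipman1969`];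
U. Görtz, T. Wedhorn, *Algebraic Geometry I* (2020), Lemma 14.9 [`GortzWedhorn2020`].
-/

noncomputable section

-- single-problem summit: the doubled namespace component `ResolutionOfSingularities` is forced
set_option linter.dupNamespace false

namespace Summit.ResolutionOfSingularities.ResolutionOfSingularities.Theorems.NoZeno.ExcCount

open CategoryTheory AlgebraicGeometry TopologicalSpace Topology IsLocalRing
open Literature.AlgebraicGeometry.Resolution

/-! ## The point-set core -/

/-- **Point-set core of the self-node case.**  `ρ : Y → X`; curve sets `E ⊆ X`, `E' ⊆ Y` with new curves `NEW ⊆ E'`, `ρ` mapping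
the old curves `E' ∖ NEW` injectively into `E`, and (T1) «two distinct curves of `E'` meet in at most one point».  If a new curve `n`
and old curves `e₁`, `e₂` pass through `y₁ ≠ y₂` (`n` through both, `e_j` through `y_j`) and `ρ y₁ = ρ y₂ = z₁`, then `ρ e₁ ≠ ρ e₂`
are two curves of `E` through `z₁`. [this work] -/
theorem exists_two_of_two_points {X Y : Scheme.{0}} (ρ : Y ⟶ X) {E : Set X} {E' NEW : Set Y}
    (hmaps : ∀ e ∈ E' \ NEW, ρ.base e ∈ E) (hinj : Set.InjOn ρ.base (E' \ NEW))
    (hT1 : ∀ e ∈ E', ∀ e' ∈ E', e ≠ e' → ∀ y₁ y₂ : Y, e ⤳ y₁ → e' ⤳ y₁ → e ⤳ y₂ → e' ⤳ y₂ → y₁ = y₂)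
    {n e₁ e₂ y₁ y₂ : Y} (hn : n ∈ NEW) (hnE : n ∈ E') (he₁ : e₁ ∈ E' \ NEW) (he₂ : e₂ ∈ E' \ NEW)
    (hny₁ : n ⤳ y₁) (hny₂ : n ⤳ y₂) (he₁y : e₁ ⤳ y₁) (he₂y : e₂ ⤳ y₂) (hy : y₁ ≠ y₂)
    {z₁ : X} (hy₁ : ρ.base y₁ = z₁) (hy₂ : ρ.base y₂ = z₁) :
    ∃ a b : X, a ∈ E ∧ b ∈ E ∧ a ≠ b ∧ a ⤳ z₁ ∧ b ⤳ z₁ := by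
  refine ⟨ρ.base e₁, ρ.base e₂, hmaps e₁ he₁, hmaps e₂ he₂, fun h => ?_,
    hy₁ ▸ he₁y.map ρ.base.hom.continuous, hy₂ ▸ he₂y.map ρ.base.hom.continuous⟩
  have h12 : e₁ = e₂ := hinj he₁ he₂ h
  subst h12
  have hne : n ≠ e₁ := fun h' => he₁.2 (h' ▸ hn)
  exact hy (hT1 n hnE e₁ he₁.1 hne y₁ y₂ hny₁ he₁y hny₂ he₂y)

/-! ## Nodes lie on exceptional curves -/

/-- A κ^sep-node lies on some integral exceptional curve and is not its generic point. [cite: Lipman1969, §16 (16.1) (p. 231)] -/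
theorem exists_excCurvePoint_specializes_of_mem_sepNodes {R : Type} [CommRing R] [IsLocalRing R] {X : Scheme.{0}}
    (π : X ⟶ Spec (.of R)) {z : X} (hz : z ∈ sepNodes π) : ∃ η ∈ excCurvePoints π, η ⤳ z ∧ z ≠ η := by
  obtain ⟨-, hz⟩ := (mem_sepNodes_iff π z).mp hz
  rcases hz with ⟨⟨η, V⟩, -, -, ⟨hη, h, hb⟩, -⟩ | ⟨η, h, V, hb, hη, -⟩
  · exact ⟨η, hη, h, ne_of_isBranchAt h hb⟩
  · exact ⟨η, hη, h, ne_of_isBranchAt h hb⟩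

/-! ## The squares -/

section Squares

variable {R R_f : Type} [CommRing R] [IsLocalRing R] [CommRing R_f] [IsLocalRing R_f]
  {X X_f X1 X1_f : Scheme.{0}}
  (π : X ⟶ Spec (.of R)) (π_f : X_f ⟶ Spec (.of R_f)) (σ : X_f ⟶ X) (g : Spec (.of R_f) ⟶ Spec (.of R))
  (hsq : σ ≫ π = π_f ≫ g) (hg : g.base ⁻¹' {closedPoint R} = {closedPoint R_f})
  (ρ : X1 ⟶ X) (ρ_f : X1_f ⟶ X_f) (σ1 : X1_f ⟶ X1) (hcomm : σ1 ≫ ρ = ρ_f ≫ σ)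

omit [IsLocalRing R] [IsLocalRing R_f] in
include hsq hcomm in
/-- The outer square `σ¹ ≫ (ρ ≫ π) = (ρ_f ≫ π_f) ≫ g` of the two stacked squares. [this work] -/
theorem sq_comp : σ1 ≫ (ρ ≫ π) = (ρ_f ≫ π_f) ≫ g := by
  rw [← Category.assoc, hcomm, Category.assoc, hsq, Category.assoc]

include hsq hg hcomm in
/-- **The self-node step.**  `z₁ ∈ N_f` (the upstairs centre, whose `σ`-images are closed points of `X`); `η¹` an exceptional curve of
`ρ ≫ π` lying over an exceptional curve `η = ρ η¹` of `π`; two points `y₁ ≠ y₂` of `X¹_f` over `z₁` with `η¹ ⤳ σ¹ y_j`.  GIVEN the node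
curves (`hcurve`), `excCurvePoints π_f = ρ_f(OLD)` with `ρ_f` injective on OLD (`himg`, `hinj`), and (T1) for `ρ_f ≫ π_f` (`hT1`), there are
two distinct exceptional curves of `π_f` through `z₁`. [this work] -/
theorem exists_two_excCurvePoints_of_selfNode [UniversallyClosed σ1] [LocallyQuasiFinite σ1] [Flat σ1]
    {N_f : Set X_f} (hNσ : ∀ z₁ ∈ N_f, IsClosed ({σ.base z₁} : Set X))
    (hcurve : ∀ z₁ ∈ N_f, ∃ n ∈ excCurvePoints (ρ_f ≫ π_f), ρ_f.base ⁻¹' {z₁} = closure {n})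
    (himg : excCurvePoints π_f =
      ρ_f.base '' (excCurvePoints (ρ_f ≫ π_f) \ {n | n ∈ excCurvePoints (ρ_f ≫ π_f) ∧ ρ_f.base n ∈ N_f}))
    (hinj : Set.InjOn ρ_f.base (excCurvePoints (ρ_f ≫ π_f) \ {n | n ∈ excCurvePoints (ρ_f ≫ π_f) ∧ ρ_f.base n ∈ N_f}))
    (hT1 : ∀ e ∈ excCurvePoints (ρ_f ≫ π_f), ∀ e' ∈ excCurvePoints (ρ_f ≫ π_f), e ≠ e' →
      ∀ y₁ y₂ : X1_f, e ⤳ y₁ → e' ⤳ y₁ → e ⤳ y₂ → e' ⤳ y₂ → y₁ = y₂)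
    {z₁ : X_f} (hz₁ : z₁ ∈ N_f) {η1 : X1} (hη1 : η1 ∈ excCurvePoints (ρ ≫ π)) (hη : ρ.base η1 ∈ excCurvePoints π)
    {y₁ y₂ : X1_f} (hy : y₁ ≠ y₂) (hy₁ : ρ_f.base y₁ = z₁) (hy₂ : ρ_f.base y₂ = z₁)
    (hs₁ : η1 ⤳ σ1.base y₁) (hs₂ : η1 ⤳ σ1.base y₂) :
    ∃ a b : X_f, a ∈ excCurvePoints π_f ∧ b ∈ excCurvePoints π_f ∧ a ≠ b ∧ a ⤳ z₁ ∧ b ⤳ z₁ := by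
  have hsq1 := sq_comp π π_f σ g hsq ρ ρ_f σ1 hcomm
  -- old curves through `y₁`, `y₂`: lifts of `η¹` along the flat `σ¹`
  obtain ⟨e₁, he₁, he₁y, hσe₁⟩ := exists_excCurvePoint_specializes_of_sq (ρ ≫ π) (ρ_f ≫ π_f) σ1 g hsq1 hg hη1 hs₁
  obtain ⟨e₂, he₂, he₂y, hσe₂⟩ := exists_excCurvePoint_specializes_of_sq (ρ ≫ π) (ρ_f ≫ π_f) σ1 g hsq1 hg hη1 hs₂
  -- they are OLD: `σ (ρ_f e_j) = ρ (σ¹ e_j) = ρ η¹` is a curve, not a (closed) image of a centre point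
  have hold : ∀ e : X1_f, e ∈ excCurvePoints (ρ_f ≫ π_f) → σ1.base e = η1 →
      e ∈ excCurvePoints (ρ_f ≫ π_f) \ {n | n ∈ excCurvePoints (ρ_f ≫ π_f) ∧ ρ_f.base n ∈ N_f} := by
    intro e he hσe
    refine ⟨he, fun hmem => ?_⟩
    have hρσ : σ.base (ρ_f.base e) = ρ.base η1 := by
      rw [← hσe]
      change (ρ_f ≫ σ).base e = (σ1 ≫ ρ).base e
      rw [hcomm]
    have h0 := Scheme.height_of_isClosed (hNσ _ hmem.2)
    rw [hρσ, hη.2] at h0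
    exact one_ne_zero h0
  -- the new curve over `z₁` passes through `y₁` and `y₂`
  obtain ⟨n, hn, hfib⟩ := hcurve z₁ hz₁
  have hny : ∀ y : X1_f, ρ_f.base y = z₁ → n ⤳ y := fun y hyz =>
    specializes_iff_mem_closure.mpr (hfib ▸ (hyz : y ∈ ρ_f.base ⁻¹' {z₁}))
  have hρn : ρ_f.base n = z₁ := by
    have : n ∈ ρ_f.base ⁻¹' {z₁} := hfib ▸ subset_closure (Set.mem_singleton n)
    exact this
  have hmaps : ∀ e ∈ excCurvePoints (ρ_f ≫ π_f) \ {n | n ∈ excCurvePoints (ρ_f ≫ π_f) ∧ ρ_f.base n ∈ N_f},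
      ρ_f.base e ∈ excCurvePoints π_f := fun e he => himg ▸ Set.mem_image_of_mem _ he
  exact exists_two_of_two_points ρ_f hmaps hinj hT1 (show n ∈ {n | n ∈ excCurvePoints (ρ_f ≫ π_f) ∧ ρ_f.base n ∈ N_f}
      from ⟨hn, hρn ▸ hz₁⟩) hn (hold e₁ he₁ hσe₁) (hold e₂ he₂ hσe₂) (hny y₁ hy₁) (hny y₂ hy₂) he₁y he₂y hy hy₁ hy₂

include hsq hg hcomm in
/-- **(S3) HSPLIT UPSTAIRS.**  Through every point `z₁` of `X_f` over a κ^sep-node of the exceptional fibre of `π` pass two DISTINCT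
integral exceptional curves of `π_f` — GIVEN, by signature: the node curves of `ρ_f` (`hcurve`), `excCurvePoints π_f = ρ_f(OLD)` with
`ρ_f` injective on OLD (`himg`, `hinj`), (T1) «two exceptional curves of `ρ_f ≫ π_f` meet at most once» (`hT1`), and the SELF-NODE
INPUT `htwo`: over a node `z` lying on exactly one exceptional curve `E_η` of `π`, every `z₁` over `z` carries two distinct points
`y₁ ≠ y₂` of `X¹_f` over it lying under an exceptional curve `η¹` of `ρ ≫ π` over `η` ((S1) sep-jump + (S2a) fibre splitting + strict
transform).  This is the `hsplit` input of `FiniteCentreBlowup.subdivision_finiteCentre` for `π_f` and the centre `σ⁻¹(sepNodes π)`.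
[cite: Lipman1969, §24 (p. 258)] -/
theorem hsplit_upstairs [UniversallyClosed σ] [LocallyQuasiFinite σ] [Flat σ]
    [UniversallyClosed σ1] [LocallyQuasiFinite σ1] [Flat σ1]
    (hcurve : ∀ z₁ : X_f, σ.base z₁ ∈ sepNodes π → ∃ n ∈ excCurvePoints (ρ_f ≫ π_f), ρ_f.base ⁻¹' {z₁} = closure {n})
    (himg : excCurvePoints π_f = ρ_f.base '' (excCurvePoints (ρ_f ≫ π_f) \
      {n | n ∈ excCurvePoints (ρ_f ≫ π_f) ∧ ρ_f.base n ∈ σ.base ⁻¹' sepNodes π}))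
    (hinj : Set.InjOn ρ_f.base (excCurvePoints (ρ_f ≫ π_f) \
      {n | n ∈ excCurvePoints (ρ_f ≫ π_f) ∧ ρ_f.base n ∈ σ.base ⁻¹' sepNodes π}))
    (hT1 : ∀ e ∈ excCurvePoints (ρ_f ≫ π_f), ∀ e' ∈ excCurvePoints (ρ_f ≫ π_f), e ≠ e' →
      ∀ y₁ y₂ : X1_f, e ⤳ y₁ → e' ⤳ y₁ → e ⤳ y₂ → e' ⤳ y₂ → y₁ = y₂)
    (htwo : ∀ z ∈ sepNodes π, ∀ η ∈ excCurvePoints π, η ⤳ z → (∀ η' ∈ excCurvePoints π, η' ⤳ z → η' = η) →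
      ∀ z₁ : X_f, σ.base z₁ = z → ∃ (η1 : X1) (y₁ y₂ : X1_f), η1 ∈ excCurvePoints (ρ ≫ π) ∧ ρ.base η1 = η ∧ y₁ ≠ y₂ ∧
        ρ_f.base y₁ = z₁ ∧ ρ_f.base y₂ = z₁ ∧ η1 ⤳ σ1.base y₁ ∧ η1 ⤳ σ1.base y₂) :
    ∀ z₁ : X_f, σ.base z₁ ∈ sepNodes π →
      ∃ a b : X_f, a ∈ excCurvePoints π_f ∧ b ∈ excCurvePoints π_f ∧ a ≠ b ∧ a ⤳ z₁ ∧ b ⤳ z₁ := by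
  intro z₁ hz₁
  obtain ⟨η, hη, hηz, -⟩ := exists_excCurvePoint_specializes_of_mem_sepNodes π hz₁
  by_cases h2 : ∃ η' ∈ excCurvePoints π, η' ⤳ σ.base z₁ ∧ η' ≠ η
  · -- two-curve node: stub-4's (NODE2-up)
    obtain ⟨η', hη', hη'z, hne⟩ := h2
    obtain ⟨a, b, ha, hb, hab, haz, hbz, -, -⟩ :=
      exists_two_excCurvePoints_specializes_of_sq' π π_f σ g hsq hg hη' hη hne hη'z hηz rfl
    exact ⟨a, b, ha, hb, hab, haz, hbz⟩
  · -- self-node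
    push Not at h2
    obtain ⟨η1, y₁, y₂, hη1, hρη, hy, hy₁, hy₂, hs₁, hs₂⟩ := htwo _ hz₁ η hη hηz (fun η' hη' h' => h2 η' hη' h') z₁ rfl
    exact exists_two_excCurvePoints_of_selfNode π π_f σ g hsq hg ρ ρ_f σ1 hcomm
      (fun w hw => isClosed_singleton_of_mem_sepNodes π hw) hcurve himg hinj hT1 hz₁ hη1 (hρη ▸ hη) hy hy₁ hy₂ hs₁ hs₂

end Squares

/-! ## Discharging `hcurve`, `himg`, `hinj`, `hT1` for the blow-up of the upstairs centre of a rational resolution -/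

section Blowup

open Scheme.IdealSheafData

variable {R : Type} [CommRing R] [IsLocalRing R]
  {S_f : Type} [CommRing S_f] [IsNoetherianRing S_f] [IsLocalRing S_f] [IsDomain S_f] [IsIntegrallyClosed S_f]
  {X X_f X1 X1_f : Scheme.{0}} [IsIntegral X_f]
  (π : X ⟶ Spec (.of R)) (π_f : X_f ⟶ Spec (.of S_f)) (σ : X_f ⟶ X) (g : Spec (.of S_f) ⟶ Spec (.of R))
  (hsq : σ ≫ π = π_f ≫ g) (hg : g.base ⁻¹' {closedPoint R} = {closedPoint S_f})
  (ρ : X1 ⟶ X) (ρ_f : X1_f ⟶ X_f) (σ1 : X1_f ⟶ X1) (hcomm : σ1 ≫ ρ = ρ_f ≫ σ)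

include hsq hg hcomm in
/-- **(S3) for the blow-up `ρ_f` of the (closed, finite) upstairs centre `σ⁻¹(sepNodes π)` of a resolution `π_f` of a RATIONAL
two-dimensional normal local domain `S_f`**: `hcurve`, `himg`, `hinj` come from res-L1-type-o5's `FiniteCentreBlowup.*` and `hT1` from (T1)
`eq_of_specializes_of_specializes` for the resolution `ρ_f ≫ π_f` (conditional on `Lipman1969_13_1_d_rat`); the self-node input `htwo`
stays a hypothesis. [cite: Lipman1969, §24 (p. 258)] -/
theorem hsplit_upstairs_of_isBlowup [UniversallyClosed σ] [LocallyQuasiFinite σ] [Flat σ]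
    [UniversallyClosed σ1] [LocallyQuasiFinite σ1] [Flat σ1]
    (h131d : Lipman1969_13_1_d_rat.{0}) (hdim : ringKrullDim S_f = 2) (hS : HasRationalSingularity S_f)
    (hπ_f : IsResolution π_f) (hNc : IsClosed (σ.base ⁻¹' sepNodes π)) (hNfin : (σ.base ⁻¹' sepNodes π).Finite)
    (hNcl : ∀ z₁ ∈ σ.base ⁻¹' sepNodes π, IsClosed ({z₁} : Set X_f))
    (hρ_f : IsBlowup ρ_f (vanishingIdeal ⟨σ.base ⁻¹' sepNodes π, hNc⟩))
    (htwo : ∀ z ∈ sepNodes π, ∀ η ∈ excCurvePoints π, η ⤳ z → (∀ η' ∈ excCurvePoints π, η' ⤳ z → η' = η) →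
      ∀ z₁ : X_f, σ.base z₁ = z → ∃ (η1 : X1) (y₁ y₂ : X1_f), η1 ∈ excCurvePoints (ρ ≫ π) ∧ ρ.base η1 = η ∧ y₁ ≠ y₂ ∧
        ρ_f.base y₁ = z₁ ∧ ρ_f.base y₂ = z₁ ∧ η1 ⤳ σ1.base y₁ ∧ η1 ⤳ σ1.base y₂) :
    ∀ z₁ : X_f, σ.base z₁ ∈ sepNodes π →
      ∃ a b : X_f, a ∈ excCurvePoints π_f ∧ b ∈ excCurvePoints π_f ∧ a ≠ b ∧ a ⤳ z₁ ∧ b ⤳ z₁ := by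
  -- every centre point lies on an exceptional curve of `π_f` (lift along the flat `σ`) and is not that curve (it is closed)
  have hNexc : ∀ z₁ ∈ σ.base ⁻¹' sepNodes π, ∃ a ∈ excCurvePoints π_f, a ⤳ z₁ ∧ z₁ ≠ a := by
    intro z₁ hz₁
    obtain ⟨η, hη, hηz, -⟩ := exists_excCurvePoint_specializes_of_mem_sepNodes π hz₁
    obtain ⟨a, ha, haz, -⟩ := exists_excCurvePoint_specializes_of_sq π π_f σ g hsq hg hη hηz
    refine ⟨a, ha, haz, fun h => ?_⟩
    have h0 := Scheme.height_of_isClosed (hNcl z₁ hz₁)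
    rw [h, ha.2] at h0
    exact one_ne_zero h0
  haveI : IsProper π_f := hπ_f.isProper
  haveI : IsProper ρ_f := FiniteCentreBlowup.isProper π_f ρ_f hNc hρ_f
  have hres : IsResolution (ρ_f ≫ π_f) := FiniteCentreBlowup.isResolution_comp π_f ρ_f hNc hNfin hNcl hNexc hπ_f hρ_f
  haveI : IsIntegral X1_f := FiniteCentreBlowup.isIntegral π_f ρ_f hNc hNcl hNexc hρ_f
  haveI : IsProper (ρ_f ≫ π_f) := hres.isProper
  haveI : IsLocallyNoetherian X1_f := LocallyOfFiniteType.isLocallyNoetherian (ρ_f ≫ π_f)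
  have hcurve := FiniteCentreBlowup.exists_curve_fibre_eq_closure π_f ρ_f hNc hNfin hNcl hNexc hdim hπ_f hρ_f
  obtain ⟨himg, hinj⟩ := FiniteCentreBlowup.excCurvePoints_eq_image π_f ρ_f hNc hNcl hcurve hρ_f
    (fun w hw => hres.height_le_one_of_base_eq_closedPoint hdim hw)
  exact hsplit_upstairs π π_f σ g hsq hg ρ ρ_f σ1 hcomm hcurve himg hinj
    (fun e he e' he' hne y₁ y₂ h₁ h₁' h₂ h₂' => eq_of_specializes_of_specializes h131d hdim hS hres he he' hne h₁ h₁' h₂ h₂')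
    htwo

end Blowup

end Summit.ResolutionOfSingularities.ResolutionOfSingularities.Theorems.NoZeno.ExcCount

end
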